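import Summits.QuantumAdvantage.QuantumAdvantage.Theorems.AbelianDialC
import Summits.QuantumAdvantage.QuantumAdvantage.Theorems.ScaleDialA
import Literature.Computability.MetaComplexity.NegModqImmunity
import Literature.Computability.MetaComplexity.SmolenskyCorrelationRestrict
import HarnessLib

/-! # ShadowDialA — part 1/4 of the landing twins of NODE «ShadowDial» (decomp-qadv lens-2 g24; node file
`g24/ShadowDial.lean`, sha256 c1ef15d9c22c1bbf…; generator `g24/tree/gen_twins.py`: namespace `Theses.ShadowDial` →
`Theorems.ShadowDial`, cut at section boundaries, docstrings added where missing, docstring-only import `AffBells22FrameJunta` dropped,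
nothing else).
Content: §1 THE DIAL (`shadow`, `StabF2`, the pieces `F2ShadowLoss3` (F, special) / `TernaryLoss3` (R, residual)), §2 `closes`
BY NAME onto `Theorems.AbelianDial.NonAbelianLoss3` (+ `closesB` onto `Theses.SparsityDial.NonCounterGenericLoss3` = stmt-27009,
`closesD` onto `DenseGenericLoss3` = 27656), §3 the special piece PROVED (`shadow_holds`, transport to `AdviceFreeQNC0.ringHardOdd_two`)
and the exactness / law-node record (`split_iff`, `residual_iff`).  The node's full docstring follows. -/

/-!
# ShadowDial — decomp-qadv lens-2 (structural dichotomy: special vs generic), generation 24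

TARGET (by name): `G := Summit.QuantumAdvantage.QuantumAdvantage.Theorems.AbelianDial.NonAbelianLoss3`, the RESIDUAL
(gen 2) of the g23 node «AbelianDial» beneath item B = stmt-27009
`Theses.SparsityDial.NonCounterGenericLoss3` (B ↔ AbelianLoss3 ∧ NonAbelianLoss3, `Theorems.AbelianDial.split_iff`);
G → B needs the g23 special piece `AbelianLoss3` (ATTACKABLE, open), G → D = 27656 needs also `CounterLoss3` (27008).
After the operator's `--resplit DenseGenericLoss3 --into CounterLoss3 AbelianLoss3 NonAbelianLoss3` (crit-1 69v57 RESPLIT VERIFIED,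
2026-08-31) G is ALSO the route item `Theses.SparsityDial.NonAbelianLoss3` (residual, IDEA-NEEDED), `Iff.rfl`-equal to the tree decl
targeted here (69v57 `j_G`), so `closes` transfers verbatim.

THE DIAL (special vs generic).  Every strategy `P : Fin n → CubeFn (ZMod 3) n` of the ring game has a BOOLEAN SHADOW:
the output bits `x ↦ [P k x = 1]` as functions `{0,1}ⁿ → 𝔽₂` (`shadow`).  SPECIAL := after a cheap stabilizer gauge (the
lineage's `pad`, same format as `StabFew` / `StabCounter` / `StabTable`) every output bit has `𝔽₂`-degree `≤ (log₂ n)^e'`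
(`StabF2 e e'`).  GENERIC := not.  The axis is the CHARACTERISTIC in which the output map is cheap — orthogonal by
construction to g21 (one `Z₃`-form), g22 (`𝔽₂`-degree of the ECHO in the flip variables, `d ≤ log₂ n`), g23 (bounded abelian
TYPE of the gate), lens-3 (`𝔽₃`-degree of the strategy), lens-1 g18/g19 (light cones, cross-talk).  NEAREST SIBLING: lens-1 g20
«PinDial» (same day, on the OddPrimeWalk item 23109, `p ≥ 5`, `√`-scale) decides a PINNED-`𝔽₂`-DEGREE special side by a pinned tube
bound; the shadow dial is the GAUGED, POLYLOG-scale characteristic-2 axis on the `p = 3` SparsityDial residual, decided by transporting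
the whole game to `RingHardOdd 2`, and BOTH of its sides carry kernel-checked inhabitant certificates (§4 `qStrat`, §5 `muxStrat`).

NODE:  `G ⟸ F2ShadowLoss3 ∧ TernaryLoss3`  (`closes`, BY NAME; `closesB`, `closesD` onto 27009 / 27656), EXACT (`split_iff`):
* `F2ShadowLoss3` (F, SPECIAL) — **WEAKER · DECIDED** (`shadow_holds`, §3): the shadow of a cheaply-`𝔽₂`-low strategy is a
  polylog-degree `𝔽₂`-polynomial map playing the SAME ring game on the SAME odd class (a gauge changes no outcome,
  `StabilizerDial.winset_pad`), so the tree's characteristic-2 theorem `AdviceFreeQNC0.ringHardOdd_two : RingHardOdd 2`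
  bounds its wins by `θ₂·2^(n-1)`, `θ₂ < 1`: polynomial loss with `C = 1` for `n ≥ 1/(1-θ₂)`; NONE of G's hypotheses
  (density, `𝔽₃`-degree, no counter, no table) is used.  The special class swallows every 2-GROUP / BOOLEAN-ALGEBRA
  phenomenon of the lineage at once: pointers and antipodal readers (`𝔽₂`-degree 1), parity tables of any rank, tables
  over 2-power moduli of bounded rank, twins / XOR / inner-product readers, juntas of support `≤ (log n)^e'` (the tree's
  junta law `AffBells22.juntaHard` has CONSTANT support), every output computed by a DECISION TREE of depth `≤ (log n)^e'`
  (adaptive local readers: a depth-`d` tree is a polynomial of degree `≤ d` over every field) — and, certified here (§5),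
  the NON-junta MULTIPLEXER family `muxStrat` (address `log₂ n − 3` cells, read the addressed one of `2^L > n/16` data
  cells): inside G's hypothesis class — `𝔽₃`-degree `log₂ n` (`muxStrat_mem_logpow`), DENSE (`mux_in_dense_class`), NOT
  counter-form and NOT `(m,r)`-table-form for any type at the zero gauge (`mux_not_counterForm_zero`,
  `mux_not_tableForm_zero`: `2^L > (m+1)^r` address patterns collide in any table row), every data cell PIVOTAL
  (`mux_pivotal`) — and inside F (`mux_stabF2`: its shadow has `𝔽₂`-degree `log₂ n − 2`).  So F cuts INTO G's class,
  strictly beyond juntas and beyond every abelian type.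
* `TernaryLoss3` (R, GENERIC = the re-typed RESIDUAL) — **≡ G · OPEN · IDEA-NEEDED**: G's text with `¬ StabF2 (c+1) e' P`
  inserted (`∃ e'`) — the ESSENTIALLY TERNARY fields: `𝔽₃`-degree `≤ (log n)^c`, dense, no cheap counter / bounded table,
  AND `𝔽₂`-degree of some output bit `> (log n)^e'` under every cheap gauge.  HONESTY: a LAW node — `residual_iff : R ↔ G`
  because F is a theorem; the EXTENSION of the residual's hypothesis class shrinks (by the F-class, which is inhabited inside
  G's class: `muxStrat`), its logical strength does not (same standing as lens-4 «TypeDial», 72v35/74v2x doctrine: VERIFIED-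
  as-LAW, RECORD only; no new ledger item is asked for).  INHABITANT WITH CERTIFICATE: the g23 matching family `qStrat`
  (`[Σ_t x_{p_t}·x_{q_k(t)} ≡ 0 (3)]`): at the zero gauge its last output bit has `𝔽₂`-degree `> (n−1)/2 − 3` — LINEAR —
  (`q_shadow_degree_linear`, hence `q_not_F2low_zero : ∀ e', eventually ¬ (all shadows ∈ lowDeg (log n)^e')`), and it is
  dense / counter-free / table-free of every type (g23: `q_in_dense_class`, `q_not_counterForm_zero`, `q_not_tableForm_zero`).
  UNDECIDED: no loss theorem for `qStrat` exists (bc/Probe F12).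

THE NEW MATHEMATICS (beyond bookkeeping over `ringHardOdd_two`): the **MÖBIUS-COEFFICIENT CERTIFICATE** of §4 — over `𝔽₂`
the top Möbius coefficient of `g : {0,1}^D → 𝔽₂` is the plain cube sum `Σ_T g(1_T)`, which VANISHES when `deg g < D`
(`cube_sum_eq_zero_of_lowDeg`, from `NegModqImmunity.mcoeff_eq_zero_of_mem_lowDegOn`); restricting the `Z₃`-matching gate to
the sub-cube «`D` chosen odd cells free, their partners ON» (a substitution, `SmolenskyCorrelationRestrict.comp_subst_mem_lowDeg`)
gives `u ↦ c ⊕ [|u| ≡ 0 (3)]`, whose cube sum is `#{T ⊆ [D] : 3 ∣ |T|}` (or its complement) — ODD iff `3 ∤ D` (`rc_zero_odd`,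
Pascal mod 3: `rc_insert`, `rc_mod_two`).  A self-contained `𝔽₂`-DEGREE LOWER BOUND ENGINE for `MOD₃`-type gates (the
Razborov–Smolensky phenomenon «`MOD₃ ∉ low 𝔽₂-degree`» in exact, non-approximate form, kernel-checked, 30 lines).

LITERATURE PLACEMENT.  Degree of one Boolean function over two characteristics: Gopalan–Lovett–Shpilka, «The complexity of
Boolean functions in different characteristics», Comput. Complexity 19 (2010) [cited p.10 of corpus:paper:arxiv-1502.00357;
p.18 of corpus:paper:doi-10-4230-lipics-icalp-2020-100; galaxy:pdf:-8905746497380040240] — `deg_q f ≥ n' /(⌈log₂ p⌉·deg_p f·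
p^{2 deg_p f})` for `f` depending on `n'` variables [quoted p.3 of corpus:paper:arxiv-1910.12458]: with `p = 3`, `q = 2` it
makes the F-class ∩ {`𝔽₃`-degree `d`} consist of functions of `≤ 2·d·9^d·(log n)^e'` relevant variables — a JUNTA COLLAPSE only
in the sub-logarithmic regime `d < (½ − ε) log₉ n`; G quantifies `d ≤ (log₂ n)^c` for EVERY `c ≥ 1`, where GLS is void
(`9^{log₂ n} ≫ n`) and the multiplexer (`d = log₂ n`, `> n/16` relevant cells) shows the F-class is genuinely larger than
juntas.  Smolensky 1987 / Razborov 1987 (MOD_p vs 𝔽_q-degree) is the approximate ancestor of §4's exact certificate.  Barrier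
catalogue: `Literature.Barriers.QuantumAdvantage.NonclassicalDegreeLogBarrier` (Bhowmick–Lovett 2015: nonclassical
polynomials of degree `O(log n)` — the residual R sits INSIDE its scope: `𝔽₃`-degree polylog ≥ log n, `𝔽₂`-degree unbounded;
F sits OUTSIDE it: F is decided by a characteristic-2 theorem already in the tree, not by a correlation bound against
parity), `Literature.Barriers.QuantumAdvantage.TwoModuliDepthTwo` (two moduli, depth two: R ⊇ the `MOD₃∘MOD₂`-flavoured
fields; F removes only the `MOD₂`-cheap ones).

DEAD CUTS (recorded so nobody re-files them): (i) a third piece «CONFINED / UNCOUPLED readers» (every dev-indicator reads a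
window meeting ≤ 1 of 5 spread flip sites) — uncoupled ⟹ additive response everywhere ⟹ `StabAdd` ⟹ decided by the tree's
`ResponseDial.addLoss3`: a bookkeeping re-application of the g19 dial, DROPPED; (ii) `√n`-junta law via AP-tuple counting —
inside `StabAdd`, dropped; (iii) `Z₃`-affine orbit-response certificates — the parity certificates span the whole 32-dim
space, none exists; (iv) per-orbit loss methods on `qStrat` (dark window / additive / coincidence / even sublattices) —
rotating partners, invariance density `2^{-n/2}`: `qStrat` is the honest residual core; (v) phase-rank dial — low rank ⊆
`(2, ρ+1)`-tables (g23 special side), high rank has no rung; (vi) windowed inner product as F-inhabitant — a polylog-junta,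
replaced by the multiplexer.

THEOREM INDEX. §1 `shadow`, `StabF2`, `F2ShadowLoss3`, `TernaryLoss3` · §2 `closes` ★, `closesB`, `closesD`, `ternary_of_G` ·
§3 `shadow_pad_zero`, `decide_shadow`, `shadow_holds` ★, `closes_residual`, `split_iff`, `residual_iff`, `closesB_residual` ·
§4 `cube_sum_eq_zero_of_lowDeg` ★, `rc`, `rc_insert`, `rc_mod_two`, `rc_zero_odd`, `card_filter_xor_odd`; `qSet`, `qEmb`,
`qG_qEmb`, `shadow_q_second`, `tGuess_qEmb`, `q_shadow_not_lowDeg` ★, `q_shadow_degree_linear`, `q_not_F2low_zero` ·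
§5 `aL`, `aW`, `acell`, `enc`, `dcell`, `bF`, `selF`, `muxPoly`, `selF_apply`, `muxPoly_apply`, `muxPoly_mem`, `muxStrat`,
`muxStrat_mem_logpow`, `mux_in_dense_class`, `mem_dev_mux_second`, `mux_shadow_mem`, `mux_stabF2` ★, `tIn`, `mux_not_tableForm` ★,
`mux_pivotal`, `mux_not_tableForm_zero`, `mux_not_counterForm_zero`.  0 `sorry`; axioms of ★ = {propext, Classical.choice,
Quot.sound}; imports the tree only (`AbelianDialC`, `ScaleDialA`, `AffBells22FrameJunta`, `NegModqImmunity`,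
`SmolenskyCorrelationRestrict`).
Nothing here proves the summit `QuantumAdvantage` (rung currency: the decided piece is rung-0 bookkeeping over the tree's
`RingHardOdd 2` plus one new certificate engine; the residual is recorded, not attacked; bc/Probe F8).
-/

set_option linter.dupNamespace false
noncomputable section
open scoped Classical

namespace Summit.QuantumAdvantage.QuantumAdvantage.Theorems.ShadowDial
open Finset
open Literature.Computability.QuantumComplexity Literature.Computability.QuantumComplexity.RingHLF
open Literature.Computability.MetaComplexity Literature.Computability.MetaComplexity.Smolensky
open Summit.QuantumAdvantage.AdviceFreeQNC0
open Summit.QuantumAdvantage.QuantumAdvantage.Theorems.AnchorDial (outB dev loss_shape_mono)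
open Summit.QuantumAdvantage.QuantumAdvantage.Theorems.HolonomyDial (tPoly tPoly_apply tPoly_mem xorP xorP_mem
  xorP_apply_bool mono_singleton_apply indP indP_apply indP_mem)
open Summit.QuantumAdvantage.QuantumAdvantage.Theorems.StabilizerDial (apIdx apStrat apStrat_mem apStrat_apply pad
  pad_mem rel_pad_iff winset_pad StabFew outB_pad_zero)
open Summit.QuantumAdvantage.QuantumAdvantage.Theorems.SparsityDial (real_loss_of_frac stabFew_mono_mr one_le_logpow)
open Summit.QuantumAdvantage.QuantumAdvantage.Theorems.ResponseDial (mem_dev_apStrat dev_pad_zero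
  not_polylogSparse_of_agree)
open Summit.QuantumAdvantage.QuantumAdvantage.Theorems.CounterDial (CounterForm StabCounter)
open Summit.QuantumAdvantage.QuantumAdvantage.Theorems.AbelianDial (alin TableForm StabTable AbelianLoss3
  NonAbelianLoss3 tableForm_of_counterForm nT pcell qcell pcell_val qcell_val pcell_injective qcell_injective
  pcell_ne_qcell qG qG_apply qG_indB qStrat qStrat_agree qStrat_mem6 q_in_dense_class mem_dev_q_second indB
  oddZeros_indB alin_indB q_not_tableForm_zero q_not_counterForm_zero)
open Summit.QuantumAdvantage.QuantumAdvantage.Theorems.ScaleDial (logpow_add_logpow_le)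

variable {N : ℕ}

/-! ## §1  THE DIAL: Boolean shadow of polylog `𝔽₂`-degree after a cheap gauge (special) versus not (generic) -/

/-- the BOOLEAN SHADOW of output position `k` of a strategy: the `𝔽₂`-valued indicator of the output bit `[Q k x = 1]`. -/
def shadow (Q : Fin N → CubeFn (ZMod 3) N) (k : Fin N) : CubeFn (ZMod 2) N :=
  fun x => if Q k x = 1 then 1 else 0

/-- **CHEAPLY `𝔽₂`-LOW at levels `(e, e')`**: some stabilizer gauge `s` of `𝔽₃`-degree `≤ (log₂ N)^e` (the lineage's gauge
format) makes EVERY output bit of the padded strategy an `𝔽₂`-polynomial of degree `≤ (log₂ N)^e'`. -/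
def StabF2 (e e' : ℕ) (P : Fin N → CubeFn (ZMod 3) N) : Prop :=
  ∃ s : Fin N → CubeFn (ZMod 3) N, (∀ i, s i ∈ lowDeg (ZMod 3) N ((Nat.log 2 N) ^ e)) ∧
    ∀ k, shadow (pad P s) k ∈ lowDeg (ZMod 2) N ((Nat.log 2 N) ^ e')

/-- **the SPECIAL piece `F2ShadowLoss3`** (a THEOREM, `shadow_holds`): cheaply `𝔽₂`-low strategies lose a polynomial
(in fact constant) fraction of the odd class — no density, no degree, no counter/table hypothesis needed. -/
def F2ShadowLoss3 : Prop :=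
  ∃ C : ℕ, ∀ e e' : ℕ, ∃ n₀ : ℕ, ∀ n ≥ n₀, ∀ P : Fin n → CubeFn (ZMod 3) n, StabF2 e e' P →
    ((univ.filter fun x : Fin n → Bool => OddZeros x ∧ Rel x (fun i => decide (P i x = 1))).card : ℝ)
      ≤ (1 - 1 / (n : ℝ) ^ C) * (2 : ℝ) ^ (n - 1)

/-- **the GENERIC piece = the RESIDUAL `TernaryLoss3`**: G's text with `¬ StabF2 (c+1) e' P` inserted (for SOME shadow
exponent `e'` and SOME abelian type `(m, r)`): dense, not cheaply counter-form, not cheaply `(m,r)`-table-form and NOT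
cheaply `𝔽₂`-low low-degree strategies lose a polynomial fraction. -/
def TernaryLoss3 : Prop :=
  ∃ e' m r : ℕ, ∃ a : ℕ, ∃ C : ℕ, ∀ c : ℕ, ∃ n₀ : ℕ, ∀ n ≥ n₀, ∀ P : Fin n → CubeFn (ZMod 3) n,
    (∀ i, P i ∈ lowDeg (ZMod 3) n ((Nat.log 2 n) ^ c)) →
      ¬ StabFew ((Nat.log 2 n) ^ a) 0 (c + 1) P → ¬ StabCounter (c + 1) P → ¬ StabTable m r (c + 1) P →
        ¬ StabF2 (c + 1) e' P →
          ((univ.filter fun x : Fin n → Bool => OddZeros x ∧ Rel x (fun i => decide (P i x = 1))).card : ℝ)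
            ≤ (1 - 1 / (n : ℝ) ^ C) * (2 : ℝ) ^ (n - 1)

/-! ## §2  THE NODE: `closes` by name, exactness, restrictions -/

/-- **`closes` — THE NODE'S DECIDING THEOREM, onto G BY NAME**: `F2ShadowLoss3 → TernaryLoss3 → NonAbelianLoss3`
(take the residual's `(e', m, r, a)`, `C := max`, `n₀ := max`, cases on `StabF2 (c+1) e' P`). -/
theorem closes (hF : F2ShadowLoss3) (hR : TernaryLoss3) : NonAbelianLoss3 := by
  obtain ⟨C₁, hF⟩ := hF
  obtain ⟨e', m, r, a, C₂, hR⟩ := hR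
  refine ⟨m, r, a, max C₁ C₂, fun c => ?_⟩
  obtain ⟨n₁, hn₁⟩ := hF (c + 1) e'
  obtain ⟨n₂, hn₂⟩ := hR c
  refine ⟨max (max n₁ n₂) 1, fun n hn P hP hgen hnc hnt => ?_⟩
  have hn1 : 1 ≤ n := le_trans (le_max_right _ _) hn
  have hn₁' : n₁ ≤ n := le_trans (le_trans (le_max_left _ _) (le_max_left _ _)) hn
  have hn₂' : n₂ ≤ n := le_trans (le_trans (le_max_right _ _) (le_max_left _ _)) hn
  by_cases hs : StabF2 (c + 1) e' P
  · exact loss_shape_mono hn1 (le_max_left _ _) _ _ (by positivity) (hn₁ n hn₁' P hs)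
  · exact loss_shape_mono hn1 (le_max_right _ _) _ _ (by positivity) (hn₂ n hn₂' P hP hgen hnc hnt hs)

/-- onto item B (stmt-27009) BY NAME, through the g23 junction `Theorems.AbelianDial.closes`:
`AbelianLoss3 → F2ShadowLoss3 → TernaryLoss3 → Theses.SparsityDial.NonCounterGenericLoss3`. -/
theorem closesB (hS : AbelianLoss3) (hF : F2ShadowLoss3) (hR : TernaryLoss3) :
    Summit.QuantumAdvantage.QuantumAdvantage.Theses.SparsityDial.NonCounterGenericLoss3 :=
  Summit.QuantumAdvantage.QuantumAdvantage.Theorems.AbelianDial.closes hS (closes hF hR)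

/-- onto item D (stmt-27656 `DenseGenericLoss3`) with the sibling A (stmt-27008 `CounterLoss3`), through the landed
junctions `Theorems.AbelianDial.closesD` / `Theorems.SparsityDial.counterSplitGlue3`. -/
theorem closesD (hA : Summit.QuantumAdvantage.QuantumAdvantage.Theses.SparsityDial.CounterLoss3) (hS : AbelianLoss3)
    (hF : F2ShadowLoss3) (hR : TernaryLoss3) :
    Summit.QuantumAdvantage.QuantumAdvantage.Theses.SparsityDial.DenseGenericLoss3 :=
  Summit.QuantumAdvantage.QuantumAdvantage.Theorems.AbelianDial.closesD hA hS (closes hF hR)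

/-- N-test, generic piece: `G → TernaryLoss3` (restriction: one more hypothesis, ignored). -/
theorem ternary_of_G (hG : NonAbelianLoss3) : TernaryLoss3 := by
  obtain ⟨m, r, a, C, h⟩ := hG
  refine ⟨0, m, r, a, C, fun c => ?_⟩
  obtain ⟨n₀, hn₀⟩ := h c
  exact ⟨n₀, fun n hn P hP hgen hnc hnt _ => hn₀ n hn P hP hgen hnc hnt⟩


/-! ## §3  THE SPECIAL PIECE IS A THEOREM: transport to the tree's `RingHardOdd 2` -/

/-- the shadow of the zero-gauge padding is the shadow of the strategy. -/
theorem shadow_pad_zero (P : Fin N → CubeFn (ZMod 3) N) (k : Fin N) :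
    shadow (pad P (fun _ => 0)) k = shadow P k := by
  funext x
  have h := congrFun (outB_pad_zero P x) k
  simp only [outB] at h
  unfold shadow
  by_cases h1 : pad P (fun _ => 0) k x = 1
  · have h2 : P k x = 1 := by simpa [h1] using h.symm
    rw [if_pos h1, if_pos h2]
  · have h2 : ¬ P k x = 1 := fun h2 => h1 (by simpa [h2] using h)
    rw [if_neg h1, if_neg h2]

/-- reading the output bits off the shadow gives the output bits. -/
theorem decide_shadow (Q : Fin N → CubeFn (ZMod 3) N) (x : Fin N → Bool) :
    (fun i => decide (shadow Q i x = 1)) = fun i => decide (Q i x = 1) := by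
  funext i
  unfold shadow
  by_cases hq : Q i x = 1
  · rw [if_pos hq, decide_eq_true hq]; decide
  · rw [if_neg hq, decide_eq_false hq]; decide

/-- **`F2ShadowLoss3` PROVED** (`C = 1`): the shadow of the padded strategy is a polylog-degree `𝔽₂`-polynomial map with
literally the same win set on the odd class (`winset_pad`), so `ringHardOdd_two` bounds the wins by `θ₂ · 2^(n-1)`, and
`θ₂ ≤ 1 - 1/n` once `n ≥ 1/(1 - θ₂)`. -/
theorem shadow_holds : F2ShadowLoss3 := by
  obtain ⟨θ, hθ, hall⟩ := ringHardOdd_two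
  obtain ⟨M, hM⟩ := exists_nat_ge (1 / (1 - θ))
  refine ⟨1, fun e e' => ?_⟩
  obtain ⟨n₀, hn₀⟩ := hall e'
  refine ⟨max n₀ (max M 1), fun n hn P hst => ?_⟩
  have hn₀' : n₀ ≤ n := le_trans (le_max_left _ _) hn
  have hM' : M ≤ n := le_trans (le_trans (le_max_left _ _) (le_max_right _ _)) hn
  have hn1 : 1 ≤ n := le_trans (le_trans (le_max_right _ _) (le_max_right _ _)) hn
  obtain ⟨s, -, hsh⟩ := hst
  have h := hn₀ n hn₀' (fun k => shadow (pad P s) k) hsh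
  have hset : (univ.filter fun x : Fin n → Bool =>
        OddZeros x ∧ Rel x (fun i => decide (shadow (pad P s) i x = 1)))
      = univ.filter fun x : Fin n → Bool => OddZeros x ∧ Rel x (fun i => decide (P i x = 1)) := by
    rw [← winset_pad P s]
    exact Finset.filter_congr fun x _ => by rw [decide_shadow]
  rw [hset] at h
  have hθn : θ ≤ 1 - 1 / (n : ℝ) ^ 1 := by
    rw [pow_one]
    have h1θ : 0 < 1 - θ := by linarith
    have hnpos : (0 : ℝ) < n := by exact_mod_cast (show 0 < n by omega)
    have hMr : 1 / (1 - θ) ≤ (n : ℝ) := le_trans hM (by exact_mod_cast hM')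
    rw [div_le_iff₀ h1θ] at hMr
    have h2 : 1 / (n : ℝ) ≤ 1 - θ := by
      rw [div_le_iff₀ hnpos]; linarith
    linarith
  exact le_trans h (mul_le_mul_of_nonneg_right hθn (by positivity))

/-- the node's residual ALONE gives G (the special piece being a theorem): the honest law-node statement. -/
theorem closes_residual (hR : TernaryLoss3) : NonAbelianLoss3 := closes shadow_holds hR

/-- EXACTNESS: `G ↔ F2ShadowLoss3 ∧ TernaryLoss3`. -/
theorem split_iff : NonAbelianLoss3 ↔ (F2ShadowLoss3 ∧ TernaryLoss3) :=
  ⟨fun h => ⟨shadow_holds, ternary_of_G h⟩, fun h => closes h.1 h.2⟩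

/-- HONESTY: the residual is equivalent to G (a law node: the extension of the hypothesis class shrinks, the logical
strength does not). -/
theorem residual_iff : TernaryLoss3 ↔ NonAbelianLoss3 := ⟨closes_residual, ternary_of_G⟩

/-- item B from the two open pieces of the lineage below it: `AbelianLoss3` (g23, ATTACKABLE) and `TernaryLoss3`. -/
theorem closesB_residual (hS : AbelianLoss3) (hR : TernaryLoss3) :
    Summit.QuantumAdvantage.QuantumAdvantage.Theses.SparsityDial.NonCounterGenericLoss3 :=
  closesB hS shadow_holds hR

end Summit.QuantumAdvantage.QuantumAdvantage.Theorems.ShadowDial
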